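import Mathlib
import Literature.MathematicalPhysics.QuantumFieldTheory.BalabanImbrieJaffe1984to88.BIJ85SigmaForm421

/-!
# `BalabanImbrieJaffe1984to88.BIJ85UnitPropagator433` — T. Bałaban, J. Imbrie, A. Jaffe, *Renormalization of the Higgs model:
minimizers, propagators and the stability of mean field theory*, Commun. Math. Phys. **97** (1985) 299–329
[BalabanImbrieJaffe1985]: Sect. 4.3 p. 311 — the unit-lattice propagator `C^{(k)}` of the curl action `Δ_k`, defined by the
functional integral **(4.3.3)**, typed as printed; an operator formula PROVED to satisfy it; the axial gauge minimizer `H_{k,Ax}`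
and the action `Δ_k` of (4.3.1)–(4.3.2) as LINEAR operators on the unit-lattice bond fields (the objects entering (5.2.1)–(5.2.5))

statement-level skeleton of published theorems with citation tags; proofs where landed; nothing here is a claim about the Yang–Mills mass gap

PDF held: `paper:balaban1985-cmp97-bij-higgs-minimizers` (journal page = PDF page + 298); p. 311 [PDF 13] read on the render
`run/shared/lean/pub/pub-balaban/t4/b2b-balaban-t4-lit2/renders/bij1985/1985-cmp97-bij-higgs-minimizers-p013-x2.png`.

THE PRINTED TEXT (p. 311, verbatim).  *"4.3. Quadratic Action for Curls.  The quadratic form σ_k simplifies on curls, namely for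
fields f of the form f = ∂B. In particular ⟨∂B, σ_k∂B⟩ = ⟨B, Δ_kB⟩, (4.3.1) which defines an action Δ_k. To give a functional
integral representation for Δ_k, we note that exp(−½⟨∂B, σ_k∂B⟩) = Z_{k,Ax}^{−1}∫𝒟Aδ(Q_kA)δ_{k,Ax}(A)exp(−½‖∂A − Q^{e*}_k∂B‖²)
= Z_{k,Ax}^{−1}∫𝒟Aδ(Q_kA − B)δ_{k,Ax}(A)exp(−½‖∂A‖²) = exp(−½⟨B, Δ_kB⟩). (4.3.2) … The action Δ_k yields the unit lattice
propagator C^{(k)}, defined as follows: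
exp(½⟨J, C^{(k)}J⟩) = (Z^{(k)})^{−1}∫𝒟Bδ(QB)δ_{Ax}(B)exp(−½⟨B, Δ_kB⟩ + ⟨B, J⟩). (4.3.3)
The actions Δ_k and propagators C^{(k)} were studied by Balaban [6II] who established that C^{(k)} is well defined …"*

WHAT IS TYPED / PROVED (SKELETON row `C1.Eq4.3.1-4.3.3`, (4.3.3) part — cells of record so far: the carrier kernel `GaugeRG.Ck` of
`BIJ85Sect4Statements`; lit-balaban HOME `run/shared/lean/pub/lit-balaban/`; Phase-2 seat p09 GEN 2, taking announced 2026-08-21T03:41Z;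
unit `lit-balaban-p09`).  Setting of `…BIJ85AxialPropagator411` §2 / `…BIJ85AxialMinimizer413` / `…BIJ85SigmaForm421` (seat p09 gen 1):
η-bond fields `E`, η-plaquette fields `F`, the curl `D : E → F`, the linear constraint subspace `V ⊆ E` (support of `δ(Q_kA)δ_{k,Ax}(A)`),
plus the unit-lattice bond fields `E₁`, a LINEAR representative map `Qs : E₁ → E` (in print `Q^{s*}_k`, (2.17): `Q_kQ^{s*}_k = I`,
`δ_{k,Ax}(Q^{s*}_kB)` — on the tori `…BIJ85Eq531Inputs.QsstarIter`, seat p30 gen 3) and the unit-lattice constraint subspace `W ⊆ E₁`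
(support of `δ(QB)δ_{Ax}(B)` in (4.3.3)); `*` = adjoint for the pairings.
* §1 — **`H_{k,Ax}` IS LINEAR**: `minOp V D = I − G_{k,Ax}∂^*∂` (`minOp_apply`: it is `…BIJ85AxialMinimizer413.minimizer` on representatives) and
  `Hop V D Qs = minOp ∘ Q^{s*}_k : E₁ →ₗ E` with **`Hop_eq_Hax`**: `Hop B = H_{k,Ax}B` (the Gaussian mean (4.1.3) at the representative `Q^{s*}_kB`,
  by gen 1's `Hax_eq_minimizer`; no zero modes of ∂ on V); (4.1.5) `Qk_Hop` (`Q_kH_{k,Ax}B = B`), Euler–Lagrange `inner_D_Hop`, class membership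
  `Hop_sub_mem`; symmetry of `G_{k,Ax}` (`axialPropagator_symm`).
* §2 — **Δ_k as a symmetric operator** `deltaOp V D Qs = (∂H_{k,Ax})^*(∂H_{k,Ax})` on `E₁`: `⟨B, Δ_kB⟩ = ‖∂H_{k,Ax}B‖²` (`inner_deltaOp`),
  `deltaOp_symm`, `deltaOp_nonneg`, and **(4.3.1)–(4.3.2)** `sigma_curl_eq_deltaOp`: `⟨f₀, σ_kf₀⟩ = ⟨B, Δ_kB⟩` for EVERY σ_k satisfying (4.2.1)
  (`IsSigmaForm`, gen 1) and `f₀` with `Q^{e*}_kf₀ = ∂(Q^{s*}_kB)` (= `∂B` pulled back: `∂Q^{s*}_k = Q^{e*}_k∂`), from gen 1's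
  `sigma_curl_eq_min_energy` — i.e. this operator IS the action that (4.3.1) *"defines"*.
* §3 — **(4.3.3) VERBATIM** as the defining property `IsUnitPropagator W Δ C` (normalization `unitZ`, sourced integral `unitGen`, the volume of
  `W`), its reduction to the (4.1.1)-shape of gen 1 when `⟨B, ΔB⟩ = ‖TB‖²` (`unitZ_eq_Z`, `unitGen_eq_gen`, `isUnitPropagator_iff`), the
  operator **`unitPropagator V D Qs W = ι_W((∂H_{k,Ax}ι_W)^*(∂H_{k,Ax}ι_W))⁻¹ι_W^*`** and **`isUnitPropagator_unitPropagator`**: it satisfies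
  (4.3.3) and `Z^{(k)} > 0`, given that `∂H_{k,Ax}` has no zero modes on `W` (for the two-scale data of (5.2.1) this follows from the p. 309
  no-zero-modes claim at the next scale: `…BIJ85Prop521Proof`); uniqueness of the form (`quadForm_eq_of_isUnitPropagator`), symmetry
  (`unitPropagator_symm`).
NOT DONE HERE.  The bounds (4.3.4)–(4.3.5) ([Balaban1984PropagatorsII]) are rows of their own; the recursion (5.2.1) and its printed proof
(5.2.3)–(5.2.5) are the sibling `…BIJ85Prop521Proof`.  No new `def … : Prop` beyond the printed defining property (4.3.3); nothing is asserted
beyond the kernel-checked algebra and integrals.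
-/

namespace Literature.MathematicalPhysics.QuantumFieldTheory.BalabanImbrieJaffe1984to88.BIJ85UnitPropagator433

open MeasureTheory
open scoped RealInnerProductSpace
open BIJ85AxialPropagator411 BIJ85AxialMinimizer413 BIJ85SigmaForm421

noncomputable section

/-! ## §1  `H_{k,Ax}` as a linear operator on the unit-lattice bond fields -/

section Minimizer

variable {E F E₁ : Type*} [NormedAddCommGroup E] [InnerProductSpace ℝ E] [FiniteDimensional ℝ E]
  [NormedAddCommGroup F] [InnerProductSpace ℝ F] [FiniteDimensional ℝ F]
  [NormedAddCommGroup E₁] [InnerProductSpace ℝ E₁]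

/-- `I − G_{k,Ax}∂^*∂` — the map `A₀ ↦ A₀ − G_{k,Ax}(∂^*∂A₀)` sending a representative of a constraint class `{δ_{k,Ax}(A), Q_kA = B} = A₀ + V`
to its minimizing configuration (`…BIJ85AxialMinimizer413.minimizer`), as a LINEAR operator. [cite: BalabanImbrieJaffe1985, (4.1.3) p.310] -/
def minOp (V : Submodule ℝ E) (D : E →ₗ[ℝ] F) : E →ₗ[ℝ] E :=
  LinearMap.id - axialPropagator V D ∘ₗ (LinearMap.adjoint D ∘ₗ D)

/-- `minOp V D A₀` is the minimizing configuration of the class of `A₀`. [cite: BalabanImbrieJaffe1985, (4.1.3) p.310] -/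
theorem minOp_apply (V : Submodule ℝ E) (D : E →ₗ[ℝ] F) (A₀ : E) : minOp V D A₀ = minimizer V D A₀ := rfl

/-- **`H_{k,Ax}` as a linear operator** on the unit-lattice bond fields B: `H_{k,Ax} = (I − G_{k,Ax}∂^*∂)Q^{s*}_k`, the minimizing configuration
of the class represented by `Q^{s*}_kB` (p. 310: *"a transformation H_{k,Ax} which maps B into such a minimizing configuration for axial gauge"*;
p. 317 (5.3.1): *"the translation A = A′ + Q^{s*}_kB"*). [cite: BalabanImbrieJaffe1985, (4.1.3) p.310] -/
def Hop (V : Submodule ℝ E) (D : E →ₗ[ℝ] F) (Qs : E₁ →ₗ[ℝ] E) : E₁ →ₗ[ℝ] E :=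
  minOp V D ∘ₗ Qs

/-- `H_{k,Ax}B` is the minimizing configuration of the class of `Q^{s*}_kB`. [cite: BalabanImbrieJaffe1985, (4.1.3) p.310] -/
theorem Hop_apply (V : Submodule ℝ E) (D : E →ₗ[ℝ] F) (Qs : E₁ →ₗ[ℝ] E) (B : E₁) :
    Hop V D Qs B = minimizer V D (Qs B) := rfl

/-- `H_{k,Ax}B − Q^{s*}_kB ∈ V`: `H_{k,Ax}B` lies in the constraint class of its representative. [cite: BalabanImbrieJaffe1985, (4.1.5) p.310] -/
theorem Hop_sub_mem (V : Submodule ℝ E) (D : E →ₗ[ℝ] F) (Qs : E₁ →ₗ[ℝ] E) (B : E₁) : Hop V D Qs B - Qs B ∈ V := by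
  rw [Hop_apply]; exact minimizer_sub_mem V D (Qs B)

/-- **(4.1.5)** for the operator: `Q_kH_{k,Ax}B = B`, for every linear `Q_k` vanishing on the constraint subspace with `Q_kQ^{s*}_k = I`
((2.19)). [cite: BalabanImbrieJaffe1985, (4.1.5) p.310] -/
theorem Qk_Hop (V : Submodule ℝ E) (D : E →ₗ[ℝ] F) (Qs : E₁ →ₗ[ℝ] E) {G' : Type*} [AddCommGroup G'] [Module ℝ G']
    (Qk : E →ₗ[ℝ] G') (hQk : ∀ v : V, Qk (v : E) = 0) (B : E₁) : Qk (Hop V D Qs B) = Qk (Qs B) := by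
  have h := hQk ⟨Hop V D Qs B - Qs B, Hop_sub_mem V D Qs B⟩
  simp only [map_sub] at h
  exact sub_eq_zero.1 h

variable [MeasurableSpace E] [BorelSpace E]

/-- **`H_{k,Ax}B` (4.1.3) IS `Hop B`**: the Gaussian mean over the class `{δ_{k,Ax}(A), Q_kA = B}` represented by `Q^{s*}_kB` equals the value
of the linear operator (no zero modes of ∂ on V; gen 1's `Hax_eq_minimizer`). [cite: BalabanImbrieJaffe1985, (4.1.3) p.310] -/
theorem Hop_eq_Hax {V : Submodule ℝ E} {D : E →ₗ[ℝ] F} (hD : ∀ v : V, D (v : E) = 0 → v = 0) (Qs : E₁ →ₗ[ℝ] E) (B : E₁) :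
    Hop V D Qs B = Hax V D (Qs B) := by
  rw [Hop_apply, Hax_eq_minimizer hD]

omit [MeasurableSpace E] [BorelSpace E] in
/-- **Euler–Lagrange**: `⟨∂H_{k,Ax}B, ∂v⟩ = 0` for every `v` of the constraint subspace (no zero modes). [cite: BalabanImbrieJaffe1985, (4.1.3) p.310] -/
theorem inner_D_Hop {V : Submodule ℝ E} {D : E →ₗ[ℝ] F} (hD : ∀ v : V, D (v : E) = 0 → v = 0) (Qs : E₁ →ₗ[ℝ] E) (B : E₁)
    (v : V) : ⟪D (Hop V D Qs B), D (v : E)⟫ = 0 := by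
  rw [Hop_apply]; exact inner_D_minimizer hD (Qs B) v

omit [MeasurableSpace E] [BorelSpace E] in
/-- `‖∂(H_{k,Ax}B + v)‖² = ‖∂H_{k,Ax}B‖² + ‖∂v‖²` for `v ∈ V`. [cite: BalabanImbrieJaffe1985, (4.1.3) p.310] -/
theorem norm_sq_D_Hop_add {V : Submodule ℝ E} {D : E →ₗ[ℝ] F} (hD : ∀ v : V, D (v : E) = 0 → v = 0) (Qs : E₁ →ₗ[ℝ] E) (B : E₁)
    (v : V) : ‖D (Hop V D Qs B + (v : E))‖ ^ 2 = ‖D (Hop V D Qs B)‖ ^ 2 + ‖D (v : E)‖ ^ 2 := by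
  rw [Hop_apply]; exact norm_sq_D_minimizer_add hD (Qs B) v

omit [MeasurableSpace E] [BorelSpace E] in
/-- `(S*S)⁻¹` is symmetric for injective `S` (here `S = ∂ι_V`). [folklore] -/
private theorem formInv_symm {W' : Type*} [NormedAddCommGroup W'] [InnerProductSpace ℝ W'] [FiniteDimensional ℝ W']
    {S : W' →ₗ[ℝ] F} (hS : Function.Injective S) (x y : W') : ⟪formInv S x, y⟫ = ⟪x, formInv S y⟫ := by
  conv_lhs => rw [← formOp_formInv hS y]
  conv_rhs => rw [← formOp_formInv hS x]
  simp only [formOp, LinearMap.comp_apply, LinearMap.adjoint_inner_right, LinearMap.adjoint_inner_left]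

omit [FiniteDimensional ℝ E] [FiniteDimensional ℝ F] [MeasurableSpace E] [BorelSpace E] in
/-- No zero modes of D on V ⇒ `∂ι_V` is injective. [folklore] -/
private theorem injective_S {V : Submodule ℝ E} {D : E →ₗ[ℝ] F} (hD : ∀ v : V, D (v : E) = 0 → v = 0) :
    Function.Injective (D ∘ₗ V.subtype) := by
  intro v w h
  have : (D ∘ₗ V.subtype) (v - w) = 0 := by rw [map_sub, h, sub_self]
  exact sub_eq_zero.1 (hD _ this)

omit [MeasurableSpace E] [BorelSpace E] in
/-- **`G_{k,Ax}` is symmetric**: `⟨G_{k,Ax}x, y⟩ = ⟨x, G_{k,Ax}y⟩` for the operator formula `ι_V(ι_V*∂*∂ι_V)⁻¹ι_V*` of gen 1 (no zero modes) — the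
second moment of a (Gaussian) measure is a symmetric form. [cite: BalabanImbrieJaffe1985, (4.1.1) p.309] -/
theorem axialPropagator_symm {V : Submodule ℝ E} {D : E →ₗ[ℝ] F} (hD : ∀ v : V, D (v : E) = 0 → v = 0) (x y : E) :
    ⟪axialPropagator V D x, y⟫ = ⟪x, axialPropagator V D y⟫ := by
  have hS := injective_S hD
  simp only [axialPropagator, LinearMap.comp_apply, Submodule.subtype_apply]
  rw [← Submodule.subtype_apply, ← LinearMap.adjoint_inner_right V.subtype, formInv_symm hS, LinearMap.adjoint_inner_left,
    Submodule.subtype_apply]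

end Minimizer

/-! ## §2  The action `Δ_k` of (4.3.1)–(4.3.2) as a symmetric operator on the unit-lattice bond fields -/

section Delta

variable {E F E₁ F' : Type*} [NormedAddCommGroup E] [InnerProductSpace ℝ E] [FiniteDimensional ℝ E]
  [NormedAddCommGroup F] [InnerProductSpace ℝ F] [FiniteDimensional ℝ F]
  [NormedAddCommGroup E₁] [InnerProductSpace ℝ E₁] [FiniteDimensional ℝ E₁]
  [NormedAddCommGroup F'] [InnerProductSpace ℝ F'] [FiniteDimensional ℝ F']

/-- **Δ_k** — the action on unit-lattice bond fields of (4.3.1)–(4.3.2), as the symmetric operator `(∂H_{k,Ax})^*(∂H_{k,Ax})`, so that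
`⟨B, Δ_kB⟩ = ‖∂H_{k,Ax}B‖²` = the minimal curl energy of the class of B (the right member of (4.3.2):
`Z_{k,Ax}^{−1}∫𝒟Aδ(Q_kA − B)δ_{k,Ax}(A)exp(−½‖∂A‖²) = exp(−½⟨B, Δ_kB⟩)` with `Z_{k,Ax}(B) = e^{−½‖∂H_{k,Ax}B‖²}Z_{k,Ax}`, gen 1's `Zax_eq`).
[cite: BalabanImbrieJaffe1985, (4.3.1) p.311] -/
def deltaOp (V : Submodule ℝ E) (D : E →ₗ[ℝ] F) (Qs : E₁ →ₗ[ℝ] E) : E₁ →ₗ[ℝ] E₁ :=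
  LinearMap.adjoint (D ∘ₗ Hop V D Qs) ∘ₗ (D ∘ₗ Hop V D Qs)

/-- `⟨B, Δ_kB′⟩ = ⟨∂H_{k,Ax}B, ∂H_{k,Ax}B′⟩`. [cite: BalabanImbrieJaffe1985, (4.3.1) p.311] -/
theorem inner_deltaOp' (V : Submodule ℝ E) (D : E →ₗ[ℝ] F) (Qs : E₁ →ₗ[ℝ] E) (B B' : E₁) :
    ⟪B, deltaOp V D Qs B'⟫ = ⟪D (Hop V D Qs B), D (Hop V D Qs B')⟫ := by
  simp only [deltaOp, LinearMap.comp_apply, LinearMap.adjoint_inner_right]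

/-- **`⟨B, Δ_kB⟩ = ‖∂H_{k,Ax}B‖²`** — the minimal curl energy of the class of B. [cite: BalabanImbrieJaffe1985, (4.3.2) p.311] -/
theorem inner_deltaOp (V : Submodule ℝ E) (D : E →ₗ[ℝ] F) (Qs : E₁ →ₗ[ℝ] E) (B : E₁) :
    ⟪B, deltaOp V D Qs B⟫ = ‖D (Hop V D Qs B)‖ ^ 2 := by
  rw [inner_deltaOp', real_inner_self_eq_norm_sq]

/-- `Δ_k` is symmetric. [cite: BalabanImbrieJaffe1985, (4.3.1) p.311] -/
theorem deltaOp_symm (V : Submodule ℝ E) (D : E →ₗ[ℝ] F) (Qs : E₁ →ₗ[ℝ] E) (B B' : E₁) :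
    ⟪deltaOp V D Qs B, B'⟫ = ⟪B, deltaOp V D Qs B'⟫ := by
  rw [real_inner_comm, inner_deltaOp', inner_deltaOp', real_inner_comm]

/-- `0 ≤ ⟨B, Δ_kB⟩`. [cite: BalabanImbrieJaffe1985, (4.3.1) p.311] -/
theorem deltaOp_nonneg (V : Submodule ℝ E) (D : E →ₗ[ℝ] F) (Qs : E₁ →ₗ[ℝ] E) (B : E₁) : 0 ≤ ⟪B, deltaOp V D Qs B⟫ := by
  rw [inner_deltaOp]; exact sq_nonneg _

variable [MeasurableSpace E] [BorelSpace E]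

omit [FiniteDimensional ℝ F'] in
/-- **(4.3.1)–(4.3.2): `⟨∂B, σ_k∂B⟩ = ⟨B, Δ_kB⟩`**, verbatim *"⟨∂B, σ_k∂B⟩ = ⟨B, Δ_kB⟩, (4.3.1) which defines an action Δ_k"* — for EVERY σ_k
satisfying the defining identity (4.2.1) (`IsSigmaForm`, with `Qes = Q^{e*}_k`) and every unit-lattice plaquette field `f₀` with
`Q^{e*}_kf₀ = ∂(Q^{s*}_kB)` (in print `f₀ = ∂B`, by `∂Q^{s*}_k = Q^{e*}_k∂`), the value of the form is `⟨B, Δ_kB⟩` for the operator `deltaOp`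
(no zero modes of ∂ on V; gen 1's `sigma_curl_eq_min_energy`). [cite: BalabanImbrieJaffe1985, (4.3.1) p.311] -/
theorem sigma_curl_eq_deltaOp {V : Submodule ℝ E} {D : E →ₗ[ℝ] F} (hD : ∀ v : V, D (v : E) = 0 → v = 0) (Qs : E₁ →ₗ[ℝ] E)
    {Qes : F' →ₗ[ℝ] F} {σ : F' →ₗ[ℝ] F'} (hσ : IsSigmaForm V D Qes σ) {f₀ : F'} {B : E₁} (hf₀ : Qes f₀ = D (Qs B)) :
    ⟪f₀, σ f₀⟫ = ⟪B, deltaOp V D Qs B⟫ := by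
  rw [sigma_curl_eq_min_energy hD hσ hf₀, inner_deltaOp, Hop_eq_Hax hD]

end Delta

/-! ## §3  (4.3.3): the unit-lattice propagator `C^{(k)}` -/

section UnitPropagator

variable {E F E₁ : Type*} [NormedAddCommGroup E] [InnerProductSpace ℝ E] [FiniteDimensional ℝ E]
  [NormedAddCommGroup F] [InnerProductSpace ℝ F] [FiniteDimensional ℝ F]
  [NormedAddCommGroup E₁] [InnerProductSpace ℝ E₁] [FiniteDimensional ℝ E₁] [MeasurableSpace E₁] [BorelSpace E₁]

/-- `Z^{(k)} = ∫𝒟Bδ(QB)δ_{Ax}(B)exp(−½⟨B, Δ_kB⟩)` — the normalization of (4.3.3) (its J = 0 value): the integral over the unit-lattice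
constraint subspace `W` (support of `δ(QB)δ_{Ax}(B)`) for the volume of `W`. [cite: BalabanImbrieJaffe1985, (4.3.3) p.311] -/
def unitZ (W : Submodule ℝ E₁) (Δ : E₁ →ₗ[ℝ] E₁) : ℝ :=
  ∫ w : W, Real.exp (-(1 / 2) * ⟪(w : E₁), Δ (w : E₁)⟫)

/-- `∫𝒟Bδ(QB)δ_{Ax}(B)exp(−½⟨B, Δ_kB⟩ + ⟨B, J⟩)` — the right member of (4.3.3) before normalization, for a source `J`.
[cite: BalabanImbrieJaffe1985, (4.3.3) p.311] -/
def unitGen (W : Submodule ℝ E₁) (Δ : E₁ →ₗ[ℝ] E₁) (J : E₁) : ℝ :=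
  ∫ w : W, Real.exp (-(1 / 2) * ⟪(w : E₁), Δ (w : E₁)⟫ + ⟪(w : E₁), J⟫)

/-- **(4.3.3) as printed — the DEFINING property of `C^{(k)}`**, verbatim: *"The action Δ_k yields the unit lattice propagator C^{(k)}, defined
as follows: exp(½⟨J, C^{(k)}J⟩) = (Z^{(k)})^{−1}∫𝒟Bδ(QB)δ_{Ax}(B)exp(−½⟨B, Δ_kB⟩ + ⟨B, J⟩). (4.3.3)"*, for every source J on the unit-lattice
bonds; `W` = the support of `δ(QB)δ_{Ax}(B)`, `Δ` = the action Δ_k. [cite: BalabanImbrieJaffe1985, (4.3.3) p.311] -/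
def IsUnitPropagator (W : Submodule ℝ E₁) (Δ : E₁ →ₗ[ℝ] E₁) (C : E₁ →ₗ[ℝ] E₁) : Prop :=
  ∀ J : E₁, Real.exp ((1 / 2) * ⟪J, C J⟫) = (unitZ W Δ)⁻¹ * unitGen W Δ J

/-- When `⟨B, ΔB⟩ = ‖TB‖²`, `Z^{(k)}` is the normalization `Z` of the (4.1.1)-shape of gen 1 for `(W, T)`. [cite: BalabanImbrieJaffe1985, (4.3.3) p.311] -/
theorem unitZ_eq_Z {W : Submodule ℝ E₁} {Δ : E₁ →ₗ[ℝ] E₁} {F₀ : Type*} [NormedAddCommGroup F₀] [InnerProductSpace ℝ F₀]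
    {T : E₁ →ₗ[ℝ] F₀} (hΔ : ∀ B : E₁, ⟪B, Δ B⟫ = ‖T B‖ ^ 2) : unitZ W Δ = Z W T := by
  unfold unitZ Z
  exact integral_congr_ae (Filter.Eventually.of_forall fun w => by simp only [hΔ])

/-- When `⟨B, ΔB⟩ = ‖TB‖²`, the sourced integral of (4.3.3) is the `gen` of the (4.1.1)-shape for `(W, T)`. [cite: BalabanImbrieJaffe1985, (4.3.3) p.311] -/
theorem unitGen_eq_gen {W : Submodule ℝ E₁} {Δ : E₁ →ₗ[ℝ] E₁} {F₀ : Type*} [NormedAddCommGroup F₀] [InnerProductSpace ℝ F₀]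
    {T : E₁ →ₗ[ℝ] F₀} (hΔ : ∀ B : E₁, ⟪B, Δ B⟫ = ‖T B‖ ^ 2) (J : E₁) : unitGen W Δ J = gen W T J := by
  unfold unitGen gen
  exact integral_congr_ae (Filter.Eventually.of_forall fun w => by simp only [hΔ])

/-- When `⟨B, ΔB⟩ = ‖TB‖²`, (4.3.3) for `(W, Δ)` is (4.1.1)'s defining identity for `(W, T)` (`IsAxialPropagator`, gen 1): the unit-lattice
propagator is an axial-gauge-type second moment one scale up. [cite: BalabanImbrieJaffe1985, (4.3.3) p.311] -/
theorem isUnitPropagator_iff {W : Submodule ℝ E₁} {Δ : E₁ →ₗ[ℝ] E₁} {F₀ : Type*} [NormedAddCommGroup F₀] [InnerProductSpace ℝ F₀]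
    {T : E₁ →ₗ[ℝ] F₀} (hΔ : ∀ B : E₁, ⟪B, Δ B⟫ = ‖T B‖ ^ 2) (C : E₁ →ₗ[ℝ] E₁) :
    IsUnitPropagator W Δ C ↔ IsAxialPropagator W T C := by
  unfold IsUnitPropagator IsAxialPropagator
  simp only [unitZ_eq_Z hΔ, unitGen_eq_gen hΔ]

/-- (4.3.3) determines the quadratic form `⟨J, C^{(k)}J⟩`. [cite: BalabanImbrieJaffe1985, (4.3.3) p.311] -/
theorem quadForm_eq_of_isUnitPropagator {W : Submodule ℝ E₁} {Δ : E₁ →ₗ[ℝ] E₁} {C C' : E₁ →ₗ[ℝ] E₁}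
    (hC : IsUnitPropagator W Δ C) (hC' : IsUnitPropagator W Δ C') (J : E₁) : ⟪J, C J⟫ = ⟪J, C' J⟫ := by
  have h := Real.exp_injective ((hC J).trans (hC' J).symm)
  linarith

/-- **An operator formula for `C^{(k)}`**: `ι_W((∂H_{k,Ax}ι_W)^*(∂H_{k,Ax}ι_W))⁻¹ι_W^*` — the (4.1.1)-type second moment
(`…BIJ85AxialPropagator411.axialPropagator`) of the Gaussian `exp(−½⟨B, Δ_kB⟩) = exp(−½‖∂H_{k,Ax}B‖²)` restricted to the unit-lattice constraint
subspace `W`. [cite: BalabanImbrieJaffe1985, (4.3.3) p.311] -/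
def unitPropagator (V : Submodule ℝ E) (D : E →ₗ[ℝ] F) (Qs : E₁ →ₗ[ℝ] E) (W : Submodule ℝ E₁) : E₁ →ₗ[ℝ] E₁ :=
  axialPropagator W (D ∘ₗ Hop V D Qs)

/-- **(4.3.3) holds for the operator formula, and `Z^{(k)} > 0`**, whenever `∂H_{k,Ax}` has no zero modes on the unit-lattice constraint
subspace `W` (gen 1's Gaussian source identity one scale up). [cite: BalabanImbrieJaffe1985, (4.3.3) p.311] -/
theorem isUnitPropagator_unitPropagator (V : Submodule ℝ E) (D : E →ₗ[ℝ] F) (Qs : E₁ →ₗ[ℝ] E) (W : Submodule ℝ E₁)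
    (hT : ∀ w : W, D (Hop V D Qs (w : E₁)) = 0 → w = 0) :
    IsUnitPropagator W (deltaOp V D Qs) (unitPropagator V D Qs W) ∧ 0 < unitZ W (deltaOp V D Qs) := by
  have hΔ : ∀ B : E₁, ⟪B, deltaOp V D Qs B⟫ = ‖(D ∘ₗ Hop V D Qs) B‖ ^ 2 := fun B => inner_deltaOp V D Qs B
  obtain ⟨h, hZ⟩ := isAxialPropagator_axialPropagator W (D ∘ₗ Hop V D Qs) hT
  refine ⟨(isUnitPropagator_iff hΔ _).2 h, ?_⟩
  rw [unitZ_eq_Z hΔ]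
  exact hZ

omit [MeasurableSpace E₁] [BorelSpace E₁] in
/-- `C^{(k)}` (operator formula) is symmetric (no zero modes of `∂H_{k,Ax}` on W). [cite: BalabanImbrieJaffe1985, (4.3.3) p.311] -/
theorem unitPropagator_symm (V : Submodule ℝ E) (D : E →ₗ[ℝ] F) (Qs : E₁ →ₗ[ℝ] E) (W : Submodule ℝ E₁)
    (hT : ∀ w : W, D (Hop V D Qs (w : E₁)) = 0 → w = 0) (x y : E₁) :
    ⟪unitPropagator V D Qs W x, y⟫ = ⟪x, unitPropagator V D Qs W y⟫ :=
  axialPropagator_symm (V := W) (D := D ∘ₗ Hop V D Qs) hT x y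

/-- For every `C^{(k)}` satisfying (4.3.3) (with the action `deltaOp`), `⟨J, C^{(k)}J⟩ = ⟨J, C₀J⟩` for the operator formula `C₀` — (4.3.3)
pins the quadratic form. [cite: BalabanImbrieJaffe1985, (4.3.3) p.311] -/
theorem quadForm_eq_unitPropagator (V : Submodule ℝ E) (D : E →ₗ[ℝ] F) (Qs : E₁ →ₗ[ℝ] E) (W : Submodule ℝ E₁)
    (hT : ∀ w : W, D (Hop V D Qs (w : E₁)) = 0 → w = 0) {C : E₁ →ₗ[ℝ] E₁} (hC : IsUnitPropagator W (deltaOp V D Qs) C) (J : E₁) :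
    ⟪J, C J⟫ = ⟪J, unitPropagator V D Qs W J⟫ :=
  quadForm_eq_of_isUnitPropagator hC (isUnitPropagator_unitPropagator V D Qs W hT).1 J

end UnitPropagator

end

end Literature.MathematicalPhysics.QuantumFieldTheory.BalabanImbrieJaffe1984to88.BIJ85UnitPropagator433
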